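import Summits.AtomisticToContinuum.BoseEinsteinCondensation.Theorems.BECGroundStateSOSPeriodicIRBoundFsumDefs
import Summits.AtomisticToContinuum.BoseEinsteinCondensation.Theorems.BECGroundStateSOSPeriodicIRBoundWFPolar
import HarnessLib

/-!
# Crux `PeriodicIRBound` (stmt-AtomisticToContinuum-3972), line `fsum-phase-pencil`, stub S2
# `stub_phaseConeBlock` — part 1: Cauchy–Schwarz in the cone `Q_{E₀} ≥ 0`

For core functions `f, g` (`C¹`, periodic, Bose-symmetric) with finite forms, the shifted form
`Q_E(h) = 𝓔_w[h] − E‖h‖²` (`eform`) polarises along real lines,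
`Q_E(f + t g) = Q_E(f) + 2t (Re B(f,g) − E Re⟨f,g⟩) + t² Q_E(g)` (`eform_add_smul`, from
`WF.qform_add_smul` and `WF.normSq_add_smul`), and for `E = E₀^per` it is non-negative on cores
(`stub_eformNonneg`); the discriminant of the non-negative real quadratic gives the **cone
Cauchy–Schwarz inequality** `(Re B(f,g) − E₀ Re⟨f,g⟩)² ≤ Q_{E₀}(f) Q_{E₀}(g)` (`sq_formRe_sub_le`, registered
by-product sub-goal `stub_fsumConeCS`). Also: the symmetry of `Re B` and `Re⟨·,·⟩` in their two arguments and
the transfer of a multiplier across `Re⟨·,·⟩`.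
-/

noncomputable section

open MeasureTheory Filter
open scoped ENNReal NNReal ComplexConjugate BigOperators

namespace Summit.AtomisticToContinuum.BoseEinsteinCondensation.Cruxes.PeriodicIRBound.FsumPhasePencil

open Literature.MathematicalPhysics.QuantumManyBody.BoseGas
open Summit.AtomisticToContinuum.BoseEinsteinCondensation.Cruxes.PeriodicIRBound.LinearPhFloorWagner.WF

variable {M : ℕ} {L : ℝ}

/-! ## Symmetry of the real pairings -/

/-- `Re B_w(f, g) = Re B_w(g, f)`: the real polarised form is symmetric (`Re(ā b) = Re(b̄ a)`). [folklore] -/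
theorem formRe_comm (w : ℝ → ℝ≥0∞) (L : ℝ) (f g : Config M → ℂ) : formRe w L f g = formRe w L g f := by
  have hc : ∀ a b : ℂ, (conj a * b).re = (conj b * a).re := fun a b => by
    rw [← Complex.conj_re (conj a * b), map_mul, Complex.conj_conj, mul_comm]
  unfold formRe
  refine integral_congr_ae (Eventually.of_forall fun X => ?_)
  simp only [hc (fderiv ℝ f X _), hc (f X)]

/-- `Re⟨f, g⟩ = Re⟨g, f⟩`. [folklore] -/
theorem innerRe_comm (L : ℝ) (f g : Config M → ℂ) : innerRe L f g = innerRe L g f := by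
  unfold innerRe
  have h : (fun X => conj (g X) * f X) = fun X => conj (conj (f X) * g X) := by
    funext X
    rw [map_mul, Complex.conj_conj, mul_comm]
  rw [h, integral_conj, Complex.conj_re]

/-- Moving a multiplier across the real pairing: `Re⟨f, m g⟩ = Re⟨m̄ f, g⟩`. [folklore] -/
theorem innerRe_mul_right (L : ℝ) (f g m : Config M → ℂ) :
    innerRe L f (fun X => m X * g X) = innerRe L (fun X => conj (m X) * f X) g := by
  unfold innerRe
  congr 1
  refine integral_congr_ae (Eventually.of_forall fun X => ?_)
  simp only [map_mul, Complex.conj_conj]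
  ring

/-! ## Polarisation of the shifted form and the cone Cauchy–Schwarz inequality -/

/-- Polarisation of `Q_E` along a real line: `Q_E(f + t g) = Q_E(f) + 2t (Re B(f,g) − E Re⟨f,g⟩) + t² Q_E(g)`
for cores with finite forms. [folklore] -/
theorem eform_add_smul (hL : 0 < L) {w : ℝ → ℝ≥0∞} (hw : Measurable w) (E : ℝ) {f g : Config M → ℂ}
    (hf : IsCore L f) (hg : IsCore L g) (hfE : qform w L f ≠ ⊤) (hgE : qform w L g ≠ ⊤) (t : ℝ) :
    eform w L E (fun X => f X + (t : ℂ) * g X) =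
      eform w L E f + 2 * t * (formRe w L f g - E * innerRe L f g) + t ^ 2 * eform w L E g := by
  unfold eform
  rw [qform_add_smul hL hw hf hg hfE hgE t,
    normSq_add_smul hL hf.contDiff.continuous hg.contDiff.continuous t]
  ring

/-- **Cone Cauchy–Schwarz**: `(Re B(f,g) − E₀ Re⟨f,g⟩)² ≤ Q_{E₀}(f) · Q_{E₀}(g)` for cores `f, g` with finite
forms (`E₀ = E₀^per(M, L)` read in `ℝ`): the real quadratic `t ↦ Q_{E₀}(f + t g)` is non-negative
(`stub_eformNonneg`), so its discriminant is non-positive. [folklore] -/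
theorem sq_formRe_sub_le (hL : 0 < L) {w : ℝ → ℝ≥0∞} (hw : Measurable w) {f g : Config M → ℂ}
    (hf : IsCore L f) (hg : IsCore L g) (hfE : qform w L f ≠ ⊤) (hgE : qform w L g ≠ ⊤) :
    (formRe w L f g - (periodicGroundStateEnergy w M L).toReal * innerRe L f g) ^ 2 ≤
      eform w L (periodicGroundStateEnergy w M L).toReal f *
        eform w L (periodicGroundStateEnergy w M L).toReal g := by
  set e₀ : ℝ := (periodicGroundStateEnergy w M L).toReal with he₀
  have key : ∀ t : ℝ, 0 ≤ eform w L e₀ g * (t * t) +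
      2 * (formRe w L f g - e₀ * innerRe L f g) * t + eform w L e₀ f := by
    intro t
    have h := stub_eformNonneg w (isCore_add_smul hf hg t)
      (qform_add_smul_ne_top hw hf.contDiff hg.contDiff hfE hgE t)
    rw [← he₀, eform_add_smul hL hw e₀ hf hg hfE hgE t] at h
    nlinarith [h]
  have hd := discrim_le_zero key
  rw [discrim] at hd
  nlinarith [hd]

/-- `|Re B(f,g) − E₀ Re⟨f,g⟩| ≤ √(Q_{E₀}(f) Q_{E₀}(g))`. [folklore] -/
theorem abs_formRe_sub_le_sqrt (hL : 0 < L) {w : ℝ → ℝ≥0∞} (hw : Measurable w) {f g : Config M → ℂ}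
    (hf : IsCore L f) (hg : IsCore L g) (hfE : qform w L f ≠ ⊤) (hgE : qform w L g ≠ ⊤) :
    |formRe w L f g - (periodicGroundStateEnergy w M L).toReal * innerRe L f g| ≤
      Real.sqrt (eform w L (periodicGroundStateEnergy w M L).toReal f *
        eform w L (periodicGroundStateEnergy w M L).toReal g) :=
  Real.abs_le_sqrt (sq_formRe_sub_le hL hw hf hg hfE hgE)

/-- The near-minimiser polar bound of the sibling line in the SECOND argument:
`|Re B(g, f) − E₀ Re⟨g, f⟩| ≤ √δ √𝓔[g]` when `𝓔[f] ≤ E₀‖f‖² + δ` (`WF.abs_formRe_sub_le` + symmetry). [folklore] -/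
theorem abs_formRe_sub_le_left (hL : 0 < L) {w : ℝ → ℝ≥0∞} (hw : Measurable w) {f g : Config M → ℂ}
    (hf : IsCore L f) (hg : IsCore L g) (hfE : qform w L f ≠ ⊤) (hgE : qform w L g ≠ ⊤)
    (hE : periodicGroundStateEnergy w M L ≠ ⊤) {δ : ℝ} (hδ : 0 ≤ δ)
    (hnear : (qform w L f).toReal ≤ (periodicGroundStateEnergy w M L).toReal * (normSq L f).toReal + δ) :
    |formRe w L g f - (periodicGroundStateEnergy w M L).toReal * innerRe L g f| ≤
      Real.sqrt δ * Real.sqrt ((qform w L g).toReal) := by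
  rw [formRe_comm w L g f, innerRe_comm L g f]
  exact abs_formRe_sub_le hL hw hf hg hfE hgE hE hδ hnear

/-! ## Real bookkeeping of the block -/

/-- The slack of the block: for `C₁, C₂ ≥ 0` and `ε > 0` there is `η ∈ (0, 1]` with `2√η C₁ ≤ ε` and
`√η C₂ ≤ ε`. [folklore] -/
theorem exists_slack_sqrt {C₁ C₂ ε : ℝ} (hC₁ : 0 ≤ C₁) (hC₂ : 0 ≤ C₂) (hε : 0 < ε) :
    ∃ η : ℝ, 0 < η ∧ η ≤ 1 ∧ 2 * Real.sqrt η * C₁ ≤ ε ∧ Real.sqrt η * C₂ ≤ ε := by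
  set K : ℝ := 2 * C₁ + C₂ + 1 with hK
  have hKpos : 0 < K := by positivity
  set s : ℝ := min 1 (ε / K) with hs
  have hs0 : 0 < s := lt_min one_pos (div_pos hε hKpos)
  have hs1 : s ≤ 1 := min_le_left _ _
  have hsK : s * K ≤ ε := by
    calc s * K ≤ ε / K * K := by gcongr; exact min_le_right _ _
      _ = ε := div_mul_cancel₀ ε hKpos.ne'
  refine ⟨s ^ 2, by positivity, ?_, ?_, ?_⟩
  · nlinarith
  · rw [Real.sqrt_sq hs0.le]; nlinarith
  · rw [Real.sqrt_sq hs0.le]; nlinarith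

/-- The real algebra of the block: from `|μ| ≤ √(Q_U Q_G) + √η c₂`, `Q_G ≤ F + 2√η c₁`, `Q_U ≥ 0` and the slack
inequalities, `|μ| ≤ √(Q_U (F + ε)) + ε`. [folklore] -/
theorem cone_block_algebra {μ QU QG F η c₁ c₂ C₁ C₂ ε : ℝ} (hQU : 0 ≤ QU) (hη : 0 ≤ η)
    (hμ : |μ| ≤ Real.sqrt (QU * QG) + Real.sqrt η * c₂) (hQG : QG ≤ F + 2 * Real.sqrt η * c₁)
    (hc₁ : c₁ ≤ C₁) (hc₂ : c₂ ≤ C₂) (h₁ : 2 * Real.sqrt η * C₁ ≤ ε) (h₂ : Real.sqrt η * C₂ ≤ ε) :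
    |μ| ≤ Real.sqrt (QU * (F + ε)) + ε := by
  have hs : 0 ≤ Real.sqrt η := Real.sqrt_nonneg η
  have _ := hη
  have hQG' : QG ≤ F + ε := by nlinarith
  have hmono : Real.sqrt (QU * QG) ≤ Real.sqrt (QU * (F + ε)) :=
    Real.sqrt_le_sqrt (mul_le_mul_of_nonneg_left hQG' hQU)
  have hc : Real.sqrt η * c₂ ≤ ε := le_trans (mul_le_mul_of_nonneg_left hc₂ hs) h₂
  linarith

/-- **Registered by-product sub-goal `stub_fsumConeCS`** (line `fsum-phase-pencil`, helper of S2
`stub_phaseConeBlock`): the cone Cauchy–Schwarz inequality `sq_formRe_sub_le`. [folklore] -/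
theorem stub_fsumConeCS : ∀ {M : ℕ} {L : ℝ}, 0 < L → ∀ {w : ℝ → ℝ≥0∞}, Measurable w → ∀ {f g : Config M → ℂ}, IsCore L f → IsCore L g → qform w L f ≠ ⊤ → qform w L g ≠ ⊤ → (formRe w L f g - (periodicGroundStateEnergy w M L).toReal * innerRe L f g) ^ 2 ≤ eform w L (periodicGroundStateEnergy w M L).toReal f * eform w L (periodicGroundStateEnergy w M L).toReal g :=
  fun hL _ hw _ _ hf hg hfE hgE => sq_formRe_sub_le hL hw hf hg hfE hgE

end Summit.AtomisticToContinuum.BoseEinsteinCondensation.Cruxes.PeriodicIRBound.FsumPhasePencil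

end
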